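import Mathlib
import HarnessLib
import Summits.AtomisticToContinuum.FouriersLaw.Theses.JunctionLocality
import Summits.AtomisticToContinuum.FouriersLaw.Theorems.JunctionLocalitySuperadditiveResistanceDeviceLiouville
import Summits.AtomisticToContinuum.FouriersLaw.Theorems.JunctionLocalitySuperadditiveResistanceKuboKernel

/-!
# Stub `stub_kuboOnsager` of line `floating-probe-bypass-laplacian` (crux stmt-AtomisticToContinuum-11748,
`JunctionLocality.SuperadditiveResistance`): the device's equilibrium Kubo matrix is an Onsager Laplacian

The registered stub (skeleton `Cruxes/SuperadditiveResistance/Lines/floating-probe-bypass-laplacian.lean`, v2):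
for `pinnedChain ω₂ lam β γ` (all `> 0`), `T > 0`, a split `N, M ≥ 2` and any family `g` of the four terminal
forward fields of the γ-probed device (`g a ∈ deviceForwardFields … (termSite N M a)`: classical mean-zero
`C² ∩ L²(μ_T)` solutions of `L_dev g_a = −(p_{s_a}² − T)`, terminals `s = (0, N−1, N, N+M−1)`), the Kubo matrix
`K_ab = γ δ_ab − (γ²/T²) ∫ g_a (p_{s_b}² − T) dμ_T` lies in `onsagerLaplacians₄` (symmetric, zero row sums, PSD,
kernel = constants). PROVED by instantiating the terminal-frame theorem `kubo_onsager_terminal` (parts I–IX,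
`Theorems/JunctionLocalitySuperadditiveResistanceKubo*.lean`): at equal temperatures the device generator is
`X_H + γ S_B` with `B = deviceWeight N M` (landed `deviceGenerator_eq`), and for `N, M ≥ 2` that weight is the
terminal weight of the four distinct sites. The vocabulary `termSite`, `deviceForwardFields`, `kuboMatrix`,
`onsagerLaplacians₄` is copied VERBATIM from the skeleton (same namespace) so that the theorem is the registered
stub by name and signature. No named fact is used; axioms are the standard three.
-/

noncomputable section

open MeasureTheory Filter Topology
open scoped ContDiff
open Literature.MathematicalPhysics.KineticTheory.HeatConduction
open Summit.AtomisticToContinuum.FouriersLaw.Theorems.SuperadditiveResistance.DeviceLiouville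
  (kin deviceGenerator deviceWeight deviceGenerator_eq kin_eq_sq liouvilleOp bathOp)
open Summit.AtomisticToContinuum.FouriersLaw.Theorems.SuperadditiveResistance.Kubo
  (termWeight kubo_onsager_terminal)

namespace Summit.AtomisticToContinuum.FouriersLaw.Cruxes.SuperadditiveResistance.FloatingProbeBypassLaplacian

/-! ## Vocabulary (verbatim from the registered skeleton) -/

/-- Terminal sites of the device for the split `(N, M)`: `0 ↦ 0` (left bath), `1 ↦ N−1`, `2 ↦ N` (the probe
pair), `3 ↦ N+M−1` (right bath). -/
def termSite (N M : ℕ) : Fin 4 → ℕ := ![0, N - 1, N, N + M - 1]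

/-- The set of equilibrium FORWARD FIELDS of the device's terminal observable at site `s`:
classical `C²` solutions `g` of `L_dev g = −(p_s² − T)` (all four thermostats at `T`), square integrable and
mean zero for the Gibbs state `μ_T` (the clauses of the first lead's `IsForwardField` without its `S_K g ∈ L²`
clause; a singleton or empty by the landed `forwardField_unique`). A solution SET (an object), not a proposition. -/
def deviceForwardFields (ω₂ lam β γ T : ℝ) (N M : ℕ) (s : ℕ) : Set (PhaseSpace (N + M) → ℝ) :=
  {g | ContDiff ℝ 2 g ∧ MemLp g 2 ((pinnedChain ω₂ lam β γ).gibbsMeasure (N + M) T) ∧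
    ∫ x, g x ∂((pinnedChain ω₂ lam β γ).gibbsMeasure (N + M) T) = 0 ∧
    ∀ x, deviceGenerator (pinnedChain ω₂ lam β γ) N M (fun _ => T) g x = -(kin (N + M) s x - T)}

/-- The device's four-terminal KUBO MATRIX from a family `g` of terminal forward fields:
`K_ab = γ δ_ab − (γ²/T²) ⟨g_a, p_{s_b}² − T⟩_{μ_T}` (`= ∂J_a/∂T_b`, `J_a = γ(T_a − ⟨p_{s_a}²⟩)`). -/
def kuboMatrix (ω₂ lam β γ T : ℝ) (N M : ℕ) (g : Fin 4 → PhaseSpace (N + M) → ℝ) :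
    Matrix (Fin 4) (Fin 4) ℝ :=
  fun a b => (if a = b then γ else 0) - γ ^ 2 / T ^ 2 *
    ∫ x, g a x * (kin (N + M) (termSite N M b) x - T) ∂((pinnedChain ω₂ lam β γ).gibbsMeasure (N + M) T)

/-- The set of four-terminal ONSAGER LAPLACIANS: symmetric, zero row sums, positive semidefinite, kernel =
constants (a cone of matrices — an object, not a proposition). -/
def onsagerLaplacians₄ : Set (Matrix (Fin 4) (Fin 4) ℝ) :=
  {K | K.IsSymm ∧ (∀ a, ∑ b, K a b = 0) ∧ (∀ θ : Fin 4 → ℝ, 0 ≤ ∑ a, ∑ b, θ a * K a b * θ b) ∧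
    (∀ θ : Fin 4 → ℝ, ∑ a, ∑ b, θ a * K a b * θ b = 0 → ∀ a b, θ a = θ b)}

/-! ## The device's terminals as a terminal frame -/

/-- `termSite N M 0 = 0`. -/
theorem termSite_zero (N M : ℕ) : termSite N M 0 = 0 := rfl
/-- `termSite N M 1 = N − 1`. -/
theorem termSite_one (N M : ℕ) : termSite N M 1 = N - 1 := rfl
/-- `termSite N M 2 = N`. -/
theorem termSite_two (N M : ℕ) : termSite N M 2 = N := rfl
/-- `termSite N M 3 = N + M − 1`. -/
theorem termSite_three (N M : ℕ) : termSite N M 3 = N + M - 1 := rfl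

/-- The four terminal sites are sites of the `(N+M)`-chain when `N, M ≥ 1`. -/
theorem termSite_lt {N M : ℕ} (hN : 1 ≤ N) (hM : 1 ≤ M) (a : Fin 4) : termSite N M a < N + M := by
  fin_cases a
  · show termSite N M 0 < N + M; rw [termSite_zero]; omega
  · show termSite N M 1 < N + M; rw [termSite_one]; omega
  · show termSite N M 2 < N + M; rw [termSite_two]; omega
  · show termSite N M 3 < N + M; rw [termSite_three]; omega

/-- The terminal map `s : Fin 4 → Fin (N+M)`. -/
def termFin (N M : ℕ) (hN : 1 ≤ N) (hM : 1 ≤ M) (a : Fin 4) : Fin (N + M) := ⟨termSite N M a, termSite_lt hN hM a⟩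

/-- For `N, M ≥ 2` the four terminal sites `0 < N−1 < N < N+M−1` are distinct. -/
theorem termFin_injective {N M : ℕ} (hN : 2 ≤ N) (hM : 2 ≤ M) :
    Function.Injective (termFin N M (by omega) (by omega)) := by
  intro a b h
  have hv : termSite N M a = termSite N M b := by
    have := congrArg Fin.val h
    simpa [termFin] using this
  fin_cases a <;> fin_cases b <;>
    simp only [termSite_zero, termSite_one, termSite_two, termSite_three, Fin.zero_eta, Fin.mk_one, Fin.isValue,
      Fin.reduceFinMk] at hv ⊢ <;> omega

/-- Terminal `0` is the left bath on site `0`. -/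
theorem termFin_zero {N M : ℕ} (hN : 2 ≤ N) (hM : 2 ≤ M) :
    termFin N M (by omega) (by omega) 0 = ⟨0, by omega⟩ := by
  apply Fin.ext; simp [termFin, termSite_zero]

/-- The indicator of a terminal site, written on the value. -/
theorem ite_termFin_eq {N M : ℕ} (hN : 1 ≤ N) (hM : 1 ≤ M) (a : Fin 4) (i : Fin (N + M)) :
    (if termFin N M hN hM a = i then (1 : ℝ) else 0) = if i.val = termSite N M a then 1 else 0 := by
  by_cases h : i.val = termSite N M a
  · rw [if_pos h, if_pos (Fin.ext (by simpa [termFin] using h.symm))]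
  · rw [if_neg h, if_neg fun e => h (by have := congrArg Fin.val e; simpa [termFin] using this.symm)]

/-- For `N, M ≥ 2` the device's thermostat weights are the terminal weights of the four terminal sites. -/
theorem deviceWeight_eq_termWeight {N M : ℕ} (hN : 2 ≤ N) (hM : 2 ≤ M) :
    deviceWeight N M = termWeight (termFin N M (by omega) (by omega)) := by
  funext i
  rw [termWeight, Fin.sum_univ_four, ite_termFin_eq, ite_termFin_eq, ite_termFin_eq, ite_termFin_eq,
    termSite_zero, termSite_one, termSite_two, termSite_three]
  simp only [deviceWeight, OscillatorChain.bathWeight]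
  ring

/-! ## The registered stub -/

/-- **S0d — KUBO–ONSAGER (fixed-`N`), PROVED.** For every split `N, M ≥ 2` and every family of terminal forward
fields of the device, the Kubo matrix is an Onsager Laplacian: SYMMETRIC (momentum reversal), ZERO ROW SUMS
(energy conservation `⟨g_a, Σ_b k_b⟩ = ⟨H, k_a⟩/γ = T²/γ`), PSD with KERNEL THE CONSTANTS (completion of the square
`Σ_a ‖∂_{p_{s_a}} g_θ‖² + Σ_a ‖∂_{p_{s_a}}(g_θ − φ_θ)‖² = T|θ|²/γ²` and the landed Liouville propagation applied to
`g_θ − θ_0 H/γ`). Instance of `kubo_onsager_terminal`. -/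
theorem stub_kuboOnsager :
    ∀ ω₂ lam β γ T : ℝ, 0 < ω₂ → 0 < lam → 0 < β → 0 < γ → 0 < T →
      ∀ N M : ℕ, 2 ≤ N → 2 ≤ M → ∀ g : Fin 4 → PhaseSpace (N + M) → ℝ,
        (∀ a : Fin 4, g a ∈ deviceForwardFields ω₂ lam β γ T N M (termSite N M a)) →
        kuboMatrix ω₂ lam β γ T N M g ∈ onsagerLaplacians₄ := by
  intro ω₂ lam β γ T hω hl hβ hγ hT N M hN hM g hg
  have hN1 : 1 ≤ N := by omega
  have hM1 : 1 ≤ M := by omega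
  have hL : 0 < N + M := by omega
  set s := termFin N M hN1 hM1 with hs_def
  have hs : Function.Injective s := termFin_injective hN hM
  have hs0 : s 0 = ⟨0, hL⟩ := termFin_zero hN hM
  have hBw : deviceWeight N M = termWeight s := deviceWeight_eq_termWeight hN hM
  -- the forward-field clauses in terminal-frame form
  have hg2 : ∀ a, ContDiff ℝ 2 (g a) := fun a => (hg a).1
  have hgL : ∀ a, MemLp (g a) 2 ((pinnedChain ω₂ lam β γ).gibbsMeasure (N + M) T) := fun a => (hg a).2.1
  have hkin : ∀ (a : Fin 4) (x : PhaseSpace (N + M)), kin (N + M) (termSite N M a) x = x.2 (s a) ^ 2 :=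
    fun a x => kin_eq_sq (termSite_lt hN1 hM1 a) x
  have hpde : ∀ a x, (1 : ℝ) * liouvilleOp (pinnedChain ω₂ lam β γ) (N + M) (g a) x +
      γ * bathOp (N + M) (termWeight s) T (g a) x = -(x.2 (s a) ^ 2 - T) := by
    intro a x
    have e := (hg a).2.2.2 x
    rw [deviceGenerator_eq, hBw, hkin a x] at e
    rw [one_mul]
    exact e
  have hK : ∀ a b, kuboMatrix ω₂ lam β γ T N M g a b = (if a = b then γ else 0) -
      γ ^ 2 / T ^ 2 * ∫ x, g a x * (x.2 (s b) ^ 2 - T) ∂((pinnedChain ω₂ lam β γ).gibbsMeasure (N + M) T) := by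
    intro a b
    simp only [kuboMatrix, hkin b]
  exact kubo_onsager_terminal hω hl.le hβ.le hL hT s hs hs0 one_ne_zero hγ hg2 hgL hpde
    (kuboMatrix ω₂ lam β γ T N M g) hK

end Summit.AtomisticToContinuum.FouriersLaw.Cruxes.SuperadditiveResistance.FloatingProbeBypassLaplacian

end
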